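import Summits.BirchSwinnertonDyer.BirchSwinnertonDyer.Theorems.KatoDescentPotSupersingularWildFineSelmerOrdinaryAnchor
import Literature.NumberTheory.EllipticCurves.FineSelmerCongruentCurves
import HarnessLib

/-!
# Route `KatoDescentPotSupersingular` (rung K9, cell `bsd-potss`): the congruence road to the Conj-A crux
# `WildFineSelmerCoatesSujatha` (item stmt-BirchSwinnertonDyer-19386) with its ONE printed input
# carried BY NAME — Lim–Sujatha 2018 Prop. 3.2 is now the Literature named fact
# `LimSujatha2018.prop32_fineSelmerDual_moduleFinite_iff_of_torsionIso` (p445851); ROUTE-FREE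
# (a `--supports … --as helper` file; seat `bsd-potss-k9-c4` g3; nothing booked, BSD is not proved by any of this)

The road files of this seat (`…WildFineSelmerCongruenceRoad.lean` p444006,
`…WildFineSelmerOrdinaryAnchor.lean` p446001) carry Lim–Sujatha's proposition SPELLED OUT as a section
hypothesis `hLS`. The statement-only Literature file `Literature/NumberTheory/EllipticCurves/FineSelmerCongruentCurves.lean`
has since been reviewed and ACCEPTED (p445851), so the inline binder is replaced here by the REGISTERED
named fact `(hLS : LimSujatha2018.prop32_fineSelmerDual_moduleFinite_iff_of_torsionIso)` (it unfolds to
the section hypothesis: the fact's inline torsion isomorphism is `O6.ModPCongruent`; its `p ≠ 2` is the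
source's standing hypothesis, and `3 ≠ 2`). Displayed in every theorem below: Lim–Sujatha, the
fine-Selmer Kato fact (p420034), GZK, modularity — all named facts of the tree — and, per row, ONE
congruent curve with (A) (or with finite `Sel_{3^∞}(·/ℚ^cyc)[3]`). CONDITIONAL (audit
`proof.conditional` on registered facts only); item 19386 is NOT closed.

References: [LimSujatha2018] §3 Prop. 3.2; [CoatesSujatha2005] §3; [Kato2004Asterisque] Thm. 14.5 (3);
[GreenbergVatsal2000] Prop. (2.8); [Miller2011LMS] Def. 1.1.
-/

set_option autoImplicit false
-- sibling precedent (`KatoDescentPotSupersingularAssembly.lean`): the directory name repeats the summit name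
set_option linter.dupNamespace false

noncomputable section

open scoped Classical

namespace Summit.BirchSwinnertonDyer.BirchSwinnertonDyer.Theorems.WildFineSelmerCongruenceFact

open WeierstrassCurve Literature.NumberTheory.EllipticCurves
  Literature.NumberTheory.EllipticCurves.Rank1Residual
  Literature.NumberTheory.EllipticCurves.Rank1Residual.Typed
  Summit.BirchSwinnertonDyer.Rank1Residual Summit.BirchSwinnertonDyer.Rank1Residual.Additive
  Summit.BirchSwinnertonDyer.Rank1Residual.O6
  Summit.BirchSwinnertonDyer.BirchSwinnertonDyer.Theorems

/-- The printed input BY NAME unfolds to the road's section hypothesis (`O6.ModPCongruent` is the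
fact's inline torsion isomorphism; defeq): a registered named fact in place of an inline binder.
[cite: LimSujatha2018, §3 Prop. 3.2] -/
theorem hLS_of_fact (hLS : LimSujatha2018.prop32_fineSelmerDual_moduleFinite_iff_of_torsionIso) :
    ∀ (W₁ W₂ : WeierstrassCurve ℚ) [W₁.IsElliptic] [W₂.IsElliptic] (p : ℕ) [Fact p.Prime],
      p ≠ 2 → ModPCongruent W₁ W₂ p → ∀ (κ : ZpExtension ℚ p), κ.IsCyclotomic →
        ((∃ (γ : Field.absoluteGaloisGroup ℚ) (D : W₁.FineSelmerDualData κ γ),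
            Module.Finite ℤ_[p] (RestrictScalars ℤ_[p] (IwasawaAlgebra p) D.X)) ↔
          ∃ (γ : Field.absoluteGaloisGroup ℚ) (D : W₂.FineSelmerDualData κ γ),
            Module.Finite ℤ_[p] (RestrictScalars ℤ_[p] (IwasawaAlgebra p) D.X)) :=
  hLS

/-- **(A) at `(W,p)`, `p ≠ 2`, from (A) at a congruent `W′` — the Lim–Sujatha input as the REGISTERED named fact `hLS`.**
[cite: LimSujatha2018, §3 Prop. 3.2] -/
theorem conjA_of_modPCongruent {W W' : WeierstrassCurve ℚ} [W.IsElliptic] [W'.IsElliptic]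
    {p : ℕ} [Fact p.Prime]
    (hLS : LimSujatha2018.prop32_fineSelmerDual_moduleFinite_iff_of_torsionIso)
    (hp : p ≠ 2) (hcong : ModPCongruent W' W p)
    (hA' : ∀ (κ : ZpExtension ℚ p), κ.IsCyclotomic →
      ∃ (γ : Field.absoluteGaloisGroup ℚ) (D : W'.FineSelmerDualData κ γ),
        Module.Finite ℤ_[p] (RestrictScalars ℤ_[p] (IwasawaAlgebra p) D.X)) :
    ∀ (κ : ZpExtension ℚ p), κ.IsCyclotomic →
      ∃ (γ : Field.absoluteGaloisGroup ℚ) (D : W.FineSelmerDualData κ γ),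
        Module.Finite ℤ_[p] (RestrictScalars ℤ_[p] (IwasawaAlgebra p) D.X) :=
  WildFineSelmerOrdinaryAnchor.conjA_of_modPCongruent_of_ne_two (hLS_of_fact hLS) hp hcong hA'

/-- **The congruence road, row form, below the REGISTERED facts p420034 (`hKatoA`), GZK, modularity and Lim–Sujatha (`hLS`, p445851)**:
on an O6 row of analytic rank `0` with `W[3]` irreducible, ONE congruent `W′` with finite
`Sel_{3^∞}(W′/ℚ^cyc)[3]` for every cyclotomic datum gives `MissingUpperBoundAt W 3`.
[cite: LimSujatha2018, §3 Prop. 3.2] [cite: GreenbergVatsal2000, §2 Prop. (2.8)]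
[cite: Kato2004Asterisque, Thm. 14.5 (3) (p. 236)] [cite: Miller2011LMS, Def. 1.1] -/
theorem missingUpperBoundAt_wild_of_congruent_of_finite_selmerInfty_pTorsion
    (hLS : LimSujatha2018.prop32_fineSelmerDual_moduleFinite_iff_of_torsionIso)
    (hKatoA :
      Kato2004.rankZero_padicValNat_sha_add_padicValNat_tamagawa_le_of_additive_potGood_of_irreducible_of_fineSelmerDual_fg)
    (hGZK : rank_eq_analyticRank_of_analyticRank_le_one) (hmod : hasEntireLFunction_rat)
    (W : WeierstrassCurve ℚ) [W.IsElliptic] [W.IsGloballyMinimal] [Fact (3 : ℕ).Prime]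
    (hr : W.analyticRank = 0) (hO : ClassO6 W 3) (hirr : W.HasIrreducibleModPGaloisRep 3)
    (hanchor : ∃ (W' : WeierstrassCurve ℚ) (_ : W'.IsElliptic), ModPCongruent W' W 3 ∧
      ∀ (κ : ZpExtension ℚ 3), κ.IsCyclotomic → Set.Finite {s : W'.selmerInfty κ | 3 • s = 0}) :
    MissingUpperBoundAt W 3 :=
  WildFineSelmerOrdinaryAnchor.missingUpperBoundAt_wild_of_congruent_of_finite_selmerInfty_pTorsion
    (hLS_of_fact hLS) hKatoA hGZK hmod W hr hO hirr hanchor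

/-- **The crux body from per-row mixed certificates under the registered Lim–Sujatha fact**: per row ONE congruent
`W′` with (A) at `(W′,3)` OR with finite `Sel_{3^∞}(W′/ℚ^cyc)[3]` ⟹ the BODY of
`WildFineSelmerCoatesSujatha` (route-free; elaborates against the route decl by defeq unfolding).
[cite: LimSujatha2018, §3 Prop. 3.2] [cite: GreenbergVatsal2000, §2 Prop. (2.8)] -/
theorem wildFineSelmerCoatesSujatha_of_mixedCertificates
    (hLS : LimSujatha2018.prop32_fineSelmerDual_moduleFinite_iff_of_torsionIso)
    (hcert : ∀ (W : WeierstrassCurve ℚ) [W.IsElliptic] [W.IsGloballyMinimal] [Fact (3 : ℕ).Prime],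
      W.analyticRank = 0 → ClassO6 W 3 → W.HasIrreducibleModPGaloisRep 3 →
      ¬ (∀ n : ℕ, W.HasSurjectiveModNGaloisRep (3 ^ n : ℕ)) → ¬ W.HasCM →
      ∃ (W' : WeierstrassCurve ℚ) (_ : W'.IsElliptic), ModPCongruent W' W 3 ∧
        ((∀ (κ : ZpExtension ℚ 3), κ.IsCyclotomic →
            ∃ (γ : Field.absoluteGaloisGroup ℚ) (D : W'.FineSelmerDualData κ γ),
              Module.Finite ℤ_[3] (RestrictScalars ℤ_[3] (IwasawaAlgebra 3) D.X)) ∨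
          ∀ (κ : ZpExtension ℚ 3), κ.IsCyclotomic → Set.Finite {s : W'.selmerInfty κ | 3 • s = 0})) :
    ∀ (W : WeierstrassCurve ℚ) [W.IsElliptic] [W.IsGloballyMinimal] [Fact (3 : ℕ).Prime],
      W.analyticRank = 0 → ClassO6 W 3 → W.HasIrreducibleModPGaloisRep 3 →
      ¬ (∀ n : ℕ, W.HasSurjectiveModNGaloisRep (3 ^ n : ℕ)) → ¬ W.HasCM →
      ∀ (κ : ZpExtension ℚ 3), κ.IsCyclotomic →
        ∃ (γ : Field.absoluteGaloisGroup ℚ) (D : W.FineSelmerDualData κ γ),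
          Module.Finite ℤ_[3] (RestrictScalars ℤ_[3] (IwasawaAlgebra 3) D.X) :=
  WildFineSelmerOrdinaryAnchor.wildFineSelmerCoatesSujatha_of_mixedCertificates (hLS_of_fact hLS) hcert

end Summit.BirchSwinnertonDyer.BirchSwinnertonDyer.Theorems.WildFineSelmerCongruenceFact

end
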